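import Summits.CriticalPhenomena.CardyFormulaZ2.Theorems.CardyComplexConeParafermionToSLESixFamiliesDiamondIdentifyMesh
import Summits.CriticalPhenomena.CardyFormulaZ2.Theorems.CardyComplexConeParafermionToSLESixFamiliesDiamondIdentifyArzela
import Summits.CriticalPhenomena.CardyFormulaZ2.Theorems.CardyComplexConeParafermionToSLESixFamiliesDiamondIdentifyExactPairs
import HarnessLib

/-!
# Line `potential-darboux-picard-diamond`, stub S4′ (`stub_identifyPotentialPh`): the subsequential potential limit on the closed diamond

Helper file of the stub `stub_identifyPotentialPh` of crux `ParafermionToSLESixFamilies` (stmt-CriticalPhenomena-11389).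
Step (i) of the identification, PACKAGED: along an admissible family of a marked diamond and a sequence of positive
meshes `u_k → 0`, given (E) of S1′ (exact pairs eventually) and clause (a) of `ClosedPrecompactness` (S3: asymptotic
equicontinuity of `δ^{2/3}Ψ` on the cells of the closed diamond), there are a subsequence `s`, exact pairs `P_k`,
constants `z_k`, a unimodular limit `a⋆` of any given unimodular anchors `a_k` (the phase anchors of S1′), and a function
`G` CONTINUOUS ON THE CLOSED DIAMOND with `u^{2/3}Ψ_k − z_k → G` UNIFORMLY ON ALL CELLS; moreover `G` is a potential limit
in the sense of `IsPotentialLimit` (so clause (b′) of S3 applies to it) and the convergence holds, after re-centring, for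
EVERY exact pair of the datum (the uniform clause of `PotentialConformalLimit`). This is `exists_subseq_potentialLimit`
(registered helper of the crux item). Inputs: the Arzelà–Ascoli packaging `subseqLimit_of_asympEquicontinuous`, the
density of the cells in the closed diamond (`eventually_dense_cells`, from the lattice file: every lattice point of the
diamond is in `Ω_δ`), `η`-chains in the compact connected closed diamond (`exists_chain`), and the affine-space bridge
`exactPair_sub_eq_of_forall_bound` between two exact pairs.
-/

noncomputable section

namespace Summit.CriticalPhenomena.CardyFormulaZ2.Cruxes.ParafermionToSLESixFamilies.PotentialDarbouxPicardDiamond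

open scoped Topology
open Filter Set Metric Complex
open Literature.Probability Literature.Probability.LatticeModels Literature.Probability.Percolation
open Literature.Probability.LatticeModels.DiscreteDobrushin
open Literature.Probability.RandomPlanarGeometry
open Summit.CriticalPhenomena.CardyFormulaZ2.Cruxes.ParafermionToSLESixFamilies.IicTraceFluxPairing (IsFamily)

/-! ## Density of the cells in the closed diamond -/

/-- **The cells are dense in the closed diamond.** Along an admissible family of a marked diamond, for every `η > 0`
and all small `δ`, every point of the CLOSED diamond is within `η` of the centre of a cell of `Λ δ`. -/
theorem eventually_dense_cells (D : DobrushinDomain) (hD : IsMarkedDiamond D) (Λ : ℝ → DiscreteDobrushin)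
    (hΛ : IsFamily D Λ) {η : ℝ} (hη : 0 < η) :
    ∀ᶠ δ in 𝓝[>] (0:ℝ), ∀ z ∈ closure D.carrier, ∃ f : Site 2, IsCell (Λ δ) f ∧ dist z (ctr δ f) < η := by
  have hgoodev := eventually_mem_meshDomain_of_isMarkedDiamond D hD
  obtain ⟨c, α, β, hα, hβ, hcar⟩ := hD
  set e : ℂ := exp (-(Real.pi / 4 : ℝ) * I) with hedef
  have he1 : ‖e‖ = 1 := norm_exp_neg_pi_div_four_mul_I
  have he0 : e ≠ 0 := fun h0 => by rw [h0, norm_zero] at he1; exact zero_ne_one he1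
  have hm : 0 < min α β := lt_min hα hβ
  have hαβ : 0 < α + β := by linarith
  -- the shrinking depth `ρ`
  set ρ : ℝ := min (min α β) (η * min α β / (4 * (α + β))) with hρ
  have hρ0 : 0 < ρ := lt_min hm (by positivity)
  have hρm : ρ ≤ min α β := min_le_left _ _
  have hρη : ρ * (α + β) / min α β ≤ η / 4 := by
    rw [div_le_iff₀ hm]
    have : ρ ≤ η * min α β / (4 * (α + β)) := min_le_right _ _
    rw [le_div_iff₀ (by positivity)] at this
    linarith
  have hsmall : ∀ᶠ δ in 𝓝[>] (0:ℝ), 0 < δ ∧ 4 * δ ≤ ρ := by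
    filter_upwards [Ioo_mem_nhdsGT (show 0 < ρ / 4 by positivity)] with δ hδ
    exact ⟨hδ.1, by linarith [hδ.2]⟩
  filter_upwards [hgoodev, hsmall] with δ hgood hδs z hz
  obtain ⟨hδ0, hδρ⟩ := hδs
  have hΩ : (Λ δ).Ω = D.carrier := hΛ.1 δ
  have hEδ : (Λ δ).δ = δ := hΛ.2.1 δ
  -- a point `z'` of the shrunken closed diamond near `z`
  have hzcl : |((z - c) * e).re| ≤ α ∧ |((z - c) * e).im| ≤ β := by
    rw [hcar, closure_tiltedBox c e he0 hα hβ] at hz; exact hz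
  obtain ⟨z', hz'K, hzz'⟩ := exists_mem_shrunk_tiltedBox c e he1 hα hβ hρ0 hρm hzcl
  -- the face at the nearest site to `z'` is a cell
  set x : Site 2 := nearestSite δ z' with hx
  have hxz' : dist (meshPoint δ x) z' ≤ δ := dist_meshPoint_nearestSite_le hδ0 z'
  have hs2 : Real.sqrt 2 < 3 / 2 := by rw [Real.sqrt_lt' (by norm_num)]; norm_num
  have hblock : ∀ y : Site 2, (∀ i, |y i - x i| ≤ 1) → meshPoint δ y ∈ (Λ δ).Ω := by
    intro y hy
    have hn := norm_meshPoint_sub_le_of_block hδ0.le hy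
    rw [← dist_eq_norm] at hn
    have hr2 : Real.sqrt 2 * δ ≤ 3 / 2 * δ := by nlinarith
    have hyz' : ‖meshPoint δ y - z'‖ ≤ 5 / 2 * δ := by
      rw [← dist_eq_norm]
      have := dist_triangle (meshPoint δ y) (meshPoint δ x) z'
      linarith
    have hX := abs_le.1 ((abs_re_tilt_sub_le c e he1 (meshPoint δ y) z').trans hyz')
    have hY := abs_le.1 ((abs_im_tilt_sub_le c e he1 (meshPoint δ y) z').trans hyz')
    have hX' := abs_le.1 hz'K.1
    have hY' := abs_le.1 hz'K.2
    rw [hΩ, hcar]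
    constructor
    · rw [abs_lt]; constructor <;> linarith
    · rw [abs_lt]; constructor <;> linarith
  have hgood' : ∀ y : Site 2, meshPoint δ y ∈ (Λ δ).Ω → y ∈ meshDomain (Λ δ).Ω δ := by rw [hΩ]; exact hgood
  have hcell : IsCell (Λ δ) x :=
    isCell_of_block (Ω := (Λ δ).Ω) (by rw [hΩ, hcar]; exact convex_tiltedBox c e α β) hgood' rfl hEδ
      (isCorner_self x) hblock
  refine ⟨x, hcell, ?_⟩
  have h1 : dist (meshPoint δ x) (ctr δ x) ≤ Real.sqrt 2 / 2 * δ := by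
    rw [dist_eq_norm]; exact norm_corner_sub_ctr_le hδ0.le (isCorner_self x)
  have hρη' : ρ ≤ η / 4 := by
    have h2 : ρ ≤ ρ * (α + β) / min α β := by
      rw [le_div_iff₀ hm]
      nlinarith [min_le_left α β, hρ0]
    linarith
  calc dist z (ctr δ x) ≤ dist z z' + dist z' (meshPoint δ x) + dist (meshPoint δ x) (ctr δ x) := dist_triangle4 _ _ _ _
    _ ≤ η / 4 + δ + Real.sqrt 2 / 2 * δ := by
        gcongr
        · exact hzz'.trans hρη
        · rw [dist_comm]; exact hxz'
    _ < η := by nlinarith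

/-! ## `η`-chains in a compact connected set -/

/-- In a preconnected set, any two points are joined by an `η`-chain inside the set. -/
theorem exists_chain {X : Set ℂ} (hX : IsPreconnected X) {η : ℝ} (hη : 0 < η) {x y : ℂ} (hx : x ∈ X) (hy : y ∈ X) :
    ∃ (n : ℕ) (p : ℕ → ℂ), p 0 = x ∧ p n = y ∧ (∀ i ≤ n, p i ∈ X) ∧ ∀ i < n, dist (p i) (p (i + 1)) < η := by
  let P : ℂ → ℂ → Prop := fun a b => ∃ (n : ℕ) (p : ℕ → ℂ), p 0 = a ∧ p n = b ∧ (∀ i ≤ n, p i ∈ X) ∧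
    ∀ i < n, dist (p i) (p (i + 1)) < η
  have hrefl : ∀ a ∈ X, P a a := fun a ha =>
    ⟨0, fun _ => a, rfl, rfl, fun i _ => ha, fun i hi => (Nat.not_lt_zero i hi).elim⟩
  have hstep : ∀ a ∈ X, ∀ b ∈ X, dist a b < η → P a b := by
    intro a ha b hb hab
    obtain ⟨n, p, hp0, hpn, hpX, hpd⟩ := hrefl a ha
    obtain ⟨q, hq0, hqn, hqX, hqd⟩ := chain_snoc hp0 hpn hpX hpd hb hab
    exact ⟨n + 1, q, hq0, hqn, hqX, hqd⟩
  have htrans : ∀ a b c, a ∈ X → b ∈ X → c ∈ X → P a b → P b c → P a c := by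
    rintro a b c - - - ⟨m, p, hp0, hpm, hpX, hpd⟩ ⟨m', q, hq0, hqm, hqX, hqd⟩
    obtain ⟨r, n, hr0, hrn, hrX, hrd⟩ := chain_append hp0 hpm hpX hpd hq0 hqm hqX hqd
    exact ⟨n, r, hr0, hrn, hrX, hrd⟩
  refine hX.induction₂' P (fun z hz => ?_) htrans hx hy
  filter_upwards [self_mem_nhdsWithin, mem_nhdsWithin_of_mem_nhds (ball_mem_nhds z hη)] with w hwX hwB
  rw [mem_ball] at hwB
  exact ⟨hstep z hz w hwX (by rwa [dist_comm]), hstep w hwX z hz hwB⟩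

/-- **A function of the cells which is constant on `η`-close cells is constant on all cells** once the cells are
`η/3`-dense in a preconnected set containing their centres. -/
theorem cellFun_const_of_local {X : Set ℂ} (hX : IsPreconnected X) {η : ℝ} (hη : 0 < η) {E : DiscreteDobrushin}
    {δ : ℝ} (hin : ∀ f, IsCell E f → ctr δ f ∈ X) (hdense : ∀ z ∈ X, ∃ f, IsCell E f ∧ dist z (ctr δ f) < η / 3)
    {d : Site 2 → ℂ} (hloc : ∀ f f', IsCell E f → IsCell E f' → dist (ctr δ f) (ctr δ f') < η → d f = d f') :
    ∀ f f', IsCell E f → IsCell E f' → d f = d f' := by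
  intro f f' hf hf'
  obtain ⟨n, p, hp0, hpn, hpX, hpd⟩ := exists_chain hX (show 0 < η / 3 by positivity) (hin f hf) (hin f' hf')
  -- cells `g i` shadowing the chain, `g 0 = f`, `g n = f'`
  classical
  have hch : ∀ i ≤ n, ∃ g : Site 2, IsCell E g ∧ dist (p i) (ctr δ g) < η / 3 := fun i hi => hdense _ (hpX i hi)
  choose! g hg using hch
  let g' : ℕ → Site 2 := fun i => if i = 0 then f else if i = n then f' else g i
  have hg' : ∀ i ≤ n, IsCell E (g' i) ∧ dist (p i) (ctr δ (g' i)) < η / 3 := by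
    intro i hi
    by_cases h0 : i = 0
    · simp only [g', h0, if_true]; rw [hp0, dist_self]; exact ⟨hf, by positivity⟩
    · by_cases hn : i = n
      · simp only [g', hn, if_true]
        rw [if_neg (by rintro rfl; exact h0 hn), hpn, dist_self]; exact ⟨hf', by positivity⟩
      · simp only [g', h0, hn, if_false]; exact hg i hi
  have hind : ∀ i ≤ n, d (g' i) = d f := by
    intro i hi
    induction i with
    | zero => simp [g']
    | succ i ih =>
      have h1 := hg' i (Nat.le_of_succ_le hi)
      have h2 := hg' (i + 1) hi
      rw [← ih (Nat.le_of_succ_le hi)]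
      refine (hloc _ _ h1.1 h2.1 ?_).symm
      calc dist (ctr δ (g' i)) (ctr δ (g' (i + 1)))
          ≤ dist (ctr δ (g' i)) (p i) + dist (p i) (p (i + 1)) + dist (p (i + 1)) (ctr δ (g' (i + 1))) :=
            dist_triangle4 _ _ _ _
        _ < η / 3 + η / 3 + η / 3 := by
            gcongr
            · rw [dist_comm]; exact h1.2
            · exact hpd i hi
            · exact h2.2
        _ = η := by ring
  by_cases hn0 : n = 0
  · subst hn0
    have h0 : ctr δ f = ctr δ f' := by rw [← hp0]; exact hpn
    exact hloc f f' hf hf' (by rw [h0, dist_self]; exact hη)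
  · have := hind n le_rfl
    simp only [g', hn0, if_false, if_true] at this
    exact this.symm

/-! ## The subsequential limit -/

/-- Inverting the centre map: the face whose centre is `ctr δ f` is `f`. -/
theorem nearestSite_ctr_sub {δ : ℝ} (hδ : δ ≠ 0) (f : Site 2) :
    nearestSite δ (ctr δ f - (δ : ℂ) * (1 + I) / 2) = f := by
  rw [ctr, add_sub_cancel_right, nearestSite_meshPoint hδ]

/-- **The subsequential potential limit on the closed diamond.** Along an admissible family of a marked diamond and
positive meshes `u_k → 0`, given (E) of S1′ and clause (a) of S3, and unimodular anchors `a_k`: there are a subsequence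
`s`, exact pairs `P_k` of `Λ (u (s k))`, constants `z_k`, a unimodular `a⋆` with `a_{s k} → a⋆`, and `G` continuous on
the closed diamond, such that `u^{2/3} Ψ_k − z_k → G` uniformly on all cells, `G` is a potential limit along `u ∘ s`
(`IsPotentialLimit`), and for every `ε > 0`, eventually every exact pair of the datum is `ε`-close to `G` on all cells
after subtracting one constant. -/
theorem exists_subseq_potentialLimit : ∀ (D : DobrushinDomain), IsMarkedDiamond D → ∀ (Λ : ℝ → DiscreteDobrushin), IsFamily D Λ → (∀ᶠ δ in 𝓝[>] (0:ℝ), ∃ Φ Ψ : Site 2 → ℂ, IsExactPair (Λ δ) δ Φ Ψ) → (∀ ε > (0:ℝ), ∃ η > (0:ℝ), ∀ᶠ δ in 𝓝[>] (0:ℝ), ∀ Φ Ψ : Site 2 → ℂ, IsExactPair (Λ δ) δ Φ Ψ → ∀ f f' : Site 2, IsCell (Λ δ) f → IsCell (Λ δ) f' → dist (ctr δ f) (ctr δ f') < η → ‖(((δ ^ ((2:ℝ) / 3) : ℝ) : ℂ)) * (Ψ f - Ψ f')‖ ≤ ε) → ∀ (u : ℕ → ℝ), (∀ k, 0 < u k)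 → Tendsto u atTop (𝓝 0) → ∀ (a : ℕ → ℂ), (∀ k, ‖a k‖ = 1) → ∃ (s : ℕ → ℕ) (P : ℕ → (Site 2 → ℂ) × (Site 2 → ℂ)) (zc : ℕ → ℂ) (alim : ℂ) (G : ℂ → ℂ), StrictMono s ∧ (∀ k, IsExactPair (Λ (u (s k))) (u (s k)) (P k).1 (P k).2) ∧ ‖alim‖ = 1 ∧ Tendsto (fun k => a (s k)) atTop (𝓝 alim) ∧ ContinuousOn G (closure D.carrier) ∧ (∀ ε > (0:ℝ), ∀ᶠ k in atTop, ∀ f : Site 2, IsCell (Λ (u (s k))) f → ‖(((u (s k)) ^ ((2:ℝ) / 3) : ℝ) : ℂ) * (P k).2 f - zc k - G (ctr (u (s k)) f)‖ ≤ ε) ∧ IsPotentialLimit D Λ (u ∘ s) G ∧ (∀ ε > (0:ℝ), ∀ᶠ k in atTop, ∀ Φ Ψ : Site 2 → ℂ, IsExactPair (Λ (u (s k))) (u (s k)) Φ Ψ → ∃ z₀ : ℂ, ∀ f : Site 2, IsCell (Λ (u (s k))) f → ‖(((u (s k)) ^ ((2:ℝ) / 3) : ℝ) : ℂ) * Ψ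 f - z₀ - G (ctr (u (s k)) f)‖ ≤ ε) := by
  intro D hD Λ hΛ hE hequi u hu hu0 a ha
  classical
  -- Step 0: exact pairs exist from `K₀` on; shift the sequence
  obtain ⟨K₀, hK₀⟩ := eventually_atTop.1 (eventually_atTop_of_eventually_nhdsGT hu hu0 hE)
  set u₀ : ℕ → ℝ := fun k => u (k + K₀) with hu₀
  have hu₀pos : ∀ k, 0 < u₀ k := fun k => hu _
  have hu₀0 : Tendsto u₀ atTop (𝓝 0) := hu0.comp (tendsto_add_atTop_nat K₀)
  have hP₀ : ∀ k, ∃ P : (Site 2 → ℂ) × (Site 2 → ℂ), IsExactPair (Λ (u₀ k)) (u₀ k) P.1 P.2 := fun k => by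
    obtain ⟨Φ, Ψ, h⟩ := hK₀ (k + K₀) (Nat.le_add_left _ _)
    exact ⟨(Φ, Ψ), h⟩
  choose P₀ hP₀ using hP₀
  -- Step 1: the data of the abstract Arzelà–Ascoli lemma
  have hconvex : Convex ℝ D.carrier := by
    obtain ⟨c, α, β, -, -, hcar⟩ := hD; rw [hcar]; exact convex_tiltedBox c _ α β
  set X : Set ℂ := closure D.carrier with hX
  have hXc : IsCompact X := D.isBounded.isCompact_closure
  have hXp : IsPreconnected X := D.isConnected.isPreconnected.closure
  set S : ℕ → Set ℂ := fun k => (fun f => ctr (u₀ k) f) '' {f | IsCell (Λ (u₀ k)) f} with hS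
  set g : ℕ → ℂ → ℂ := fun k x =>
    (((u₀ k) ^ ((2:ℝ) / 3) : ℝ) : ℂ) * (P₀ k).2 (nearestSite (u₀ k) (x - ((u₀ k : ℝ) : ℂ) * (1 + I) / 2)) with hg
  have hgctr : ∀ k f, g k (ctr (u₀ k) f) = (((u₀ k) ^ ((2:ℝ) / 3) : ℝ) : ℂ) * (P₀ k).2 f := fun k f => by
    simp only [hg]; rw [nearestSite_ctr_sub (hu₀pos k).ne']
  have hctr_mem : ∀ k f, IsCell (Λ (u₀ k)) f → ctr (u₀ k) f ∈ D.carrier := fun k f hf => by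
    have h1 : (Λ (u₀ k)).Ω = D.carrier := hΛ.1 _
    have h2 : (Λ (u₀ k)).δ = u₀ k := hΛ.2.1 _
    have := ctr_mem_carrier_of_isCell (E := Λ (u₀ k)) (by rw [h1]; exact hconvex) hf
    rwa [h1, h2] at this
  have hSX : ∀ k, S k ⊆ X := by
    rintro k _ ⟨f, hf, rfl⟩
    exact subset_closure (hctr_mem k f hf)
  have hequiS : ∀ ε > (0:ℝ), ∃ η > (0:ℝ), ∀ᶠ k in atTop, ∀ x ∈ S k, ∀ y ∈ S k, dist x y < η →
      ‖g k x - g k y‖ ≤ ε := by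
    intro ε hε
    obtain ⟨η, hη, hev⟩ := hequi ε hε
    refine ⟨η, hη, ?_⟩
    filter_upwards [eventually_atTop_of_eventually_nhdsGT hu₀pos hu₀0 hev] with k hk
    rintro _ ⟨f, hf, rfl⟩ _ ⟨f', hf', rfl⟩ hd
    rw [hgctr, hgctr, ← mul_sub]
    exact hk _ _ (hP₀ k) f f' hf hf' hd
  have hdenseS : ∀ η > (0:ℝ), ∀ᶠ k in atTop, ∀ x ∈ X, ∃ y ∈ S k, dist x y < η := by
    intro η hη
    filter_upwards [eventually_atTop_of_eventually_nhdsGT hu₀pos hu₀0 (eventually_dense_cells D hD Λ hΛ hη)]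
      with k hk x hx
    obtain ⟨f, hf, hd⟩ := hk x hx
    exact ⟨ctr (u₀ k) f, ⟨f, hf, rfl⟩, hd⟩
  -- Step 2: Arzelà–Ascoli
  obtain ⟨φ, zφ, G, hφ, hGc, hconv⟩ := subseqLimit_of_asympEquicontinuous X S g hXc hXp hSX hequiS hdenseS
  -- Step 3: a further subsequence along which the anchors converge
  obtain ⟨alim, halim, ψ, hψ, hlim⟩ :=
    (isCompact_sphere (0:ℂ) 1).tendsto_subseq (x := fun k => a (φ k + K₀)) fun k => by
      rw [mem_sphere_zero_iff_norm]; exact ha _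
  have hψt : Tendsto ψ atTop atTop := hψ.tendsto_atTop
  -- the final data
  set s : ℕ → ℕ := fun k => φ (ψ k) + K₀ with hs
  have hsmono : StrictMono s := fun i j hij => by
    simp only [hs]; exact Nat.add_lt_add_right (hφ (hψ hij)) _
  have hus : ∀ k, u (s k) = u₀ (φ (ψ k)) := fun k => rfl
  refine ⟨s, fun k => P₀ (φ (ψ k)), fun k => zφ (ψ k), alim, G, hsmono, fun k => hP₀ _,
    by rwa [mem_sphere_zero_iff_norm] at halim, hlim, hGc, ?_, ?_, ?_⟩
  · -- uniform convergence on all cells along `s`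
    intro ε hε
    filter_upwards [hψt.eventually (hconv ε hε)] with k hk f hf
    have := hk (ctr (u₀ (φ (ψ k))) f) ⟨f, hf, rfl⟩
    rwa [hgctr] at this
  · -- `IsPotentialLimit`
    refine ⟨fun k => P₀ (φ (ψ k)), fun k => zφ (ψ k), fun k => hP₀ _, fun K _ _ ε hε => ?_⟩
    filter_upwards [hψt.eventually (hconv ε hε)] with k hk f hf _
    have := hk (ctr (u₀ (φ (ψ k))) f) ⟨f, hf, rfl⟩
    rwa [hgctr] at this
  · -- every exact pair, re-centred
    intro ε hε
    obtain ⟨η₁, hη₁, hev₁⟩ := hequi 1 one_pos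
    have hev₁' := eventually_atTop_of_eventually_nhdsGT hu₀pos hu₀0 hev₁
    have hdense₁ := eventually_atTop_of_eventually_nhdsGT hu₀pos hu₀0
      (eventually_dense_cells D hD Λ hΛ (show 0 < η₁ / 3 by positivity))
    filter_upwards [hψt.eventually (hconv ε hε), (hφ.tendsto_atTop.comp hψt).eventually hev₁',
      (hφ.tendsto_atTop.comp hψt).eventually hdense₁] with k hk hb₁ hd₁ Φ Ψ hPair
    set m : ℕ := φ (ψ k) with hm
    -- the difference of the two exact pairs is constant on all cells
    set d : Site 2 → ℂ := fun f => Ψ f - (P₀ m).2 f with hd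
    have hloc : ∀ f f', IsCell (Λ (u₀ m)) f → IsCell (Λ (u₀ m)) f' → dist (ctr (u₀ m) f) (ctr (u₀ m) f') < η₁ →
        d f = d f' := fun f f' hf hf' hdist =>
      exactPair_sub_eq_of_forall_bound (Λ (u₀ m)) (u₀ m) 1 η₁ (hu₀pos m) hb₁ _ _ Φ Ψ (hP₀ m) hPair f f' hf hf' hdist
    have hconst : ∀ f f', IsCell (Λ (u₀ m)) f → IsCell (Λ (u₀ m)) f' → d f = d f' :=
      cellFun_const_of_local hXp hη₁ (fun f hf => subset_closure (hctr_mem m f hf)) (fun z hz => hd₁ z hz) hloc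
    by_cases hex : ∃ f₀, IsCell (Λ (u₀ m)) f₀
    · obtain ⟨f₀, hf₀⟩ := hex
      refine ⟨zφ (ψ k) + (((u₀ m) ^ ((2:ℝ) / 3) : ℝ) : ℂ) * d f₀, fun f hf => ?_⟩
      have h1 := hk (ctr (u₀ m) f) ⟨f, hf, rfl⟩
      rw [hgctr] at h1
      have h2 : Ψ f = (P₀ m).2 f + d f₀ := by rw [← hconst f f₀ hf hf₀]; simp only [hd]; ring
      rw [show u (s k) = u₀ m from rfl, h2]
      calc ‖(((u₀ m) ^ ((2:ℝ) / 3) : ℝ) : ℂ) * ((P₀ m).2 f + d f₀) -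
            (zφ (ψ k) + (((u₀ m) ^ ((2:ℝ) / 3) : ℝ) : ℂ) * d f₀) - G (ctr (u₀ m) f)‖
          = ‖(((u₀ m) ^ ((2:ℝ) / 3) : ℝ) : ℂ) * (P₀ m).2 f - zφ (ψ k) - G (ctr (u₀ m) f)‖ := by ring_nf
        _ ≤ ε := h1
    · refine ⟨0, fun f hf => (hex ⟨f, hf⟩).elim⟩

end Summit.CriticalPhenomena.CardyFormulaZ2.Cruxes.ParafermionToSLESixFamilies.PotentialDarbouxPicardDiamond

end
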